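import Literature.NumberTheory.LFunctions.ConnesProlateGuessSupNorm
import HarnessLib

/-!
# Prolate functions past the turning point: no zeros, monotone decay, tails, Riccati bounds

Elementary ODE facts for a prolate function `f = h_{n,λ}` (`IsProlateFunction lam n f`, eigenvalue
`χ`: `−((λ²−x²)f′)′ + (2πλx)²f = χf`) in the classically forbidden region `(2πλx)² ≥ χ`, i.e.
`x ≥ x_* = √χ/(2πλ)`, proved from the structure `IsProlateFunction` ALONE (no spectral theory, no
asymptotics imported):

* `turning_false_aux`: the generic mechanism — if `g ≥ 0`, `g′ ≥ 0` at a point `x₀ ≥ x_*` and `g > 0`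
  just to the right, then the flux `(λ²−x²)g′` increases and stays bounded below by a positive
  constant up to `λ`, contradicting `(λ²−x²)g′ → 0` (`g′` bounded);
* `IsProlateFunction.ne_zero_of_turning`: `f` has no zero in `[x₀, λ)` (uses `zeros_finite`);
  `mul_deriv_neg_of_turning`: `f·f′ < 0` there; `abs_antitoneOn_of_turning`: `|f|` decreases;
  `abs_apply_lam_le_of_turning`: `|f(λ)| ≤ |f(x)|`;
* tails: `((2πλX)² − χ)∫_X^λ|f| ≤ (λ²−X²)|f′(X)|` (`integral_abs_le_of_turning`),
  `((2πλX)² − χ)|f(λ)| ≤ (λ+X)|f′(X)|` (`abs_apply_lam_le_deriv_of_turning`),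
  `∫_X^λ|f′|(1+x) ≤ (1+X)|f(X)| + ∫_X^λ|f| + (1+λ)|f(λ)|` (`integral_abs_deriv_mul_le_of_turning`);
* Riccati bounds for the logarithmic flux `W(X) = −(λ²−X²)f′(X)/f(X) > 0`:
  `W(X) < λ²(2π(X+1) + 1)` (`riccati_upper`, finite-time blow-up of `w′ ≥ w² − K²`) and
  `W(X) ≥ λ²·2πθX` for `θ < 1` under explicit largeness conditions (`riccati_lower`, `w` would hit
  `0`), via the fencing lemma `image_le_of_deriv_right_lt_deriv_boundary'`.

These feed the Sturm–Picone eigenvalue pinning `χ_n(λ)/λ² → 2π(2n+1)` and the tail estimates of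
the RH-free proof of Connes' Fact 6.4 (`prolateGuess_tendsto_riemannXi`).  THIS IS NOT AN RH
STATEMENT. [cite: SlepianPollak1961, §III; Connes2026Letter, §6.3; folklore (Sturm comparison,
Riccati equation)]
-/

noncomputable section

open Real Set MeasureTheory Filter Topology intervalIntegral

namespace Literature.NumberTheory.LFunctions

/-! ### The generic forbidden-region mechanism -/

/-- **No growth past the turning point.**  Let `g` be differentiable on `[x₀, λ)` with flux
`(λ²−x²)g′` of derivative `((2πλx)² − χ)g`, `χ ≤ (2πλx₀)²`, `0 ≤ x₀`, `|g′| ≤ B`.  If `g(x₀) ≥ 0`,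
`g′(x₀) ≥ 0` and `g > 0` on some `(x₀, x₀+h)`, contradiction: `g` stays positive, the flux strictly
increases, so it is bounded below by a positive constant near `λ`, where it is `≤ (λ²−x²)B → 0`.
[folklore] -/
theorem turning_false_aux {g g' : ℝ → ℝ} {lam χ x₀ h B : ℝ} (hx₀ : 0 ≤ x₀) (hx₀l : x₀ < lam)
    (hχ : χ ≤ (2 * π * lam * x₀) ^ 2)
    (hg : ∀ x ∈ Ico x₀ lam, HasDerivAt g (g' x) x)
    (hP : ∀ x ∈ Ico x₀ lam,
      HasDerivAt (fun y ↦ (lam ^ 2 - y ^ 2) * g' y) (((2 * π * lam * x) ^ 2 - χ) * g x) x)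
    (hB : ∀ x ∈ Ico x₀ lam, |g' x| ≤ B)
    (h0 : 0 ≤ g x₀) (h0' : 0 ≤ g' x₀) (hh : 0 < h) (hpos : ∀ x ∈ Ioo x₀ (x₀ + h), 0 < g x) :
    False := by
  have hlam : 0 < lam := lt_of_le_of_lt hx₀ hx₀l
  have hgc : ContinuousOn g (Ico x₀ lam) := fun x hx ↦ (hg x hx).continuousAt.continuousWithinAt
  have hPc : ContinuousOn (fun y ↦ (lam ^ 2 - y ^ 2) * g' y) (Ico x₀ lam) :=
    fun x hx ↦ (hP x hx).continuousAt.continuousWithinAt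
  have hcoef : ∀ t, x₀ < t → 0 < (2 * π * lam * t) ^ 2 - χ := by
    intro t ht
    have h1 : 2 * π * lam * x₀ < 2 * π * lam * t :=
      mul_lt_mul_of_pos_left ht (by positivity)
    have h2 : (2 * π * lam * x₀) ^ 2 < (2 * π * lam * t) ^ 2 :=
      pow_lt_pow_left₀ h1 (by positivity) two_ne_zero
    linarith
  have hP0 : 0 ≤ (lam ^ 2 - x₀ ^ 2) * g' x₀ := mul_nonneg (by nlinarith) h0'
  -- (1) the flux is strictly increasing on `[x₀, x₁]` as long as `g > 0` on `(x₀, x₁)`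
  have hPmono : ∀ x₁, x₁ < lam → (∀ t ∈ Ioo x₀ x₁, 0 < g t) →
      StrictMonoOn (fun y ↦ (lam ^ 2 - y ^ 2) * g' y) (Icc x₀ x₁) := by
    intro x₁ hx₁ hpos₁
    refine strictMonoOn_of_deriv_pos (convex_Icc _ _)
      (hPc.mono fun t ht ↦ ⟨ht.1, lt_of_le_of_lt ht.2 hx₁⟩) fun t ht ↦ ?_
    rw [interior_Icc] at ht
    rw [(hP t ⟨ht.1.le, ht.2.trans hx₁⟩).deriv]
    exact mul_pos (hcoef t ht.1) (hpos₁ t ht)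
  -- (2) hence `g` is strictly increasing there
  have hgmono : ∀ x₁, x₁ < lam → (∀ t ∈ Ioo x₀ x₁, 0 < g t) → StrictMonoOn g (Icc x₀ x₁) := by
    intro x₁ hx₁ hpos₁
    refine strictMonoOn_of_deriv_pos (convex_Icc _ _)
      (hgc.mono fun t ht ↦ ⟨ht.1, lt_of_le_of_lt ht.2 hx₁⟩) fun t ht ↦ ?_
    rw [interior_Icc] at ht
    rw [(hg t ⟨ht.1.le, ht.2.trans hx₁⟩).deriv]
    have hPt : (lam ^ 2 - x₀ ^ 2) * g' x₀ < (lam ^ 2 - t ^ 2) * g' t :=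
      hPmono x₁ hx₁ hpos₁ (left_mem_Icc.2 (ht.1.le.trans ht.2.le)) ⟨ht.1.le, ht.2.le⟩ ht.1
    have hlt : 0 < lam ^ 2 - t ^ 2 := by
      have h1 : t < lam := ht.2.trans hx₁
      have h2 : 0 ≤ t := hx₀.trans ht.1.le
      nlinarith
    have hprod : 0 < (lam ^ 2 - t ^ 2) * g' t := lt_of_le_of_lt hP0 hPt
    by_contra hcon
    have : (lam ^ 2 - t ^ 2) * g' t ≤ 0 :=
      mul_nonpos_iff.2 (Or.inl ⟨hlt.le, not_lt.1 hcon⟩)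
    linarith
  -- (3) `g > 0` on `(x₀, λ)`
  have hgpos : ∀ x ∈ Ioo x₀ lam, 0 < g x := by
    by_contra hcon
    push Not at hcon
    obtain ⟨x₂, hx₂, hgx₂⟩ := hcon
    have hx₂h : x₀ + h ≤ x₂ := by
      by_contra hlt
      exact absurd (hpos x₂ ⟨hx₂.1, not_le.1 hlt⟩) (not_lt.2 hgx₂)
    set S : Set ℝ := Icc (x₀ + h / 2) x₂ ∩ g ⁻¹' Iic 0 with hS
    have hSc : IsClosed S :=
      (hgc.mono (fun t ht ↦ ⟨by linarith [ht.1], lt_of_le_of_lt ht.2 hx₂.2⟩)).preimage_isClosed_of_isClosed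
        isClosed_Icc isClosed_Iic
    have hScpt : IsCompact S := isCompact_Icc.of_isClosed_subset hSc inter_subset_left
    have hSne : S.Nonempty := ⟨x₂, ⟨by linarith, le_rfl⟩, hgx₂⟩
    obtain ⟨x₁, ⟨hx₁I, hgx₁⟩, hleast⟩ := hScpt.exists_isLeast hSne
    have hgx₁' : g x₁ ≤ 0 := hgx₁
    have hx₁l : x₁ < lam := lt_of_le_of_lt hx₁I.2 hx₂.2
    have hpos₁ : ∀ t ∈ Ioo x₀ x₁, 0 < g t := by
      intro t ht
      by_cases hth : t < x₀ + h
      · exact hpos t ⟨ht.1, hth⟩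
      · by_contra hgt
        have htS : t ∈ S := ⟨⟨by linarith [not_lt.1 hth], ht.2.le.trans hx₁I.2⟩, not_lt.1 hgt⟩
        exact absurd (hleast htS) (not_le.2 ht.2)
    have hx₀x₁ : x₀ < x₁ := by linarith [hx₁I.1]
    have hlt : g x₀ < g x₁ :=
      hgmono x₁ hx₁l hpos₁ (left_mem_Icc.2 hx₀x₁.le) (right_mem_Icc.2 hx₀x₁.le) hx₀x₁
    linarith
  -- (4) the flux is `≥ c > 0` from `t₁` on, but `≤ (λ² − x²)B → 0` near `λ`
  set t₁ : ℝ := (x₀ + lam) / 2 with ht₁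
  have ht₁0 : x₀ < t₁ := by rw [ht₁]; linarith
  have ht₁l : t₁ < lam := by rw [ht₁]; linarith
  have hc : (lam ^ 2 - x₀ ^ 2) * g' x₀ < (lam ^ 2 - t₁ ^ 2) * g' t₁ :=
    hPmono t₁ ht₁l (fun t ht ↦ hgpos t ⟨ht.1, ht.2.trans ht₁l⟩) (left_mem_Icc.2 ht₁0.le)
      (right_mem_Icc.2 ht₁0.le) ht₁0
  set c : ℝ := (lam ^ 2 - t₁ ^ 2) * g' t₁ with hcdef
  have hc0 : 0 < c := lt_of_le_of_lt hP0 hc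
  have hB0 : 0 ≤ B := (abs_nonneg _).trans (hB x₀ ⟨le_rfl, hx₀l⟩)
  set η : ℝ := c / (2 * lam * (B + 1)) with hη
  have hη0 : 0 < η := by positivity
  set x : ℝ := max t₁ (lam - η) with hxdef
  have hxt₁ : t₁ ≤ x := le_max_left _ _
  have hxl : x < lam := max_lt ht₁l (by linarith)
  have hx0' : 0 ≤ x := by linarith [ht₁0.le]
  have hlamx : lam - x ≤ η := by have := le_max_right t₁ (lam - η); linarith
  have hPx : c ≤ (lam ^ 2 - x ^ 2) * g' x := by
    rcases eq_or_lt_of_le hxt₁ with h | h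
    · rw [← h]
    · exact le_of_lt (hPmono x hxl (fun t ht ↦ hgpos t ⟨ht.1, ht.2.trans hxl⟩)
        ⟨ht₁0.le, hxt₁⟩ (right_mem_Icc.2 (ht₁0.le.trans hxt₁)) h)
  have hPx' : (lam ^ 2 - x ^ 2) * g' x ≤ 2 * lam * η * B := by
    have h1 : g' x ≤ B := (le_abs_self _).trans (hB x ⟨ht₁0.le.trans hxt₁, hxl⟩)
    have h2 : 0 ≤ lam ^ 2 - x ^ 2 := by nlinarith
    have h3 : lam ^ 2 - x ^ 2 ≤ 2 * lam * η := by nlinarith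
    calc (lam ^ 2 - x ^ 2) * g' x ≤ (lam ^ 2 - x ^ 2) * B := mul_le_mul_of_nonneg_left h1 h2
      _ ≤ 2 * lam * η * B := mul_le_mul_of_nonneg_right h3 hB0
  have hfin : 2 * lam * η * B < c := by
    have e : 2 * lam * η * B = c * (B / (B + 1)) := by
      rw [hη]; field_simp
    rw [e]
    have hB1 : B / (B + 1) < 1 := by rw [div_lt_one (by linarith)]; linarith
    calc c * (B / (B + 1)) < c * 1 := mul_lt_mul_of_pos_left hB1 hc0
      _ = c := mul_one c
  linarith

namespace IsProlateFunction

variable {lam : ℝ} {n : ℕ} {f : ℝ → ℝ}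

/-- `f′` is continuous on `(−λ, λ)`. [folklore] -/
theorem continuousOn_deriv (hf : IsProlateFunction lam n f) :
    ContinuousOn (deriv f) (Ioo (-lam) lam) :=
  hf.contDiffOn_deriv_Ioo.continuousOn

/-- `|f| ≤ B₀` on `[−λ, λ]` for some `B₀`. [folklore] -/
theorem exists_bound_Icc (hf : IsProlateFunction lam n f) :
    ∃ B₀ : ℝ, 0 ≤ B₀ ∧ ∀ x ∈ Icc (-lam) lam, |f x| ≤ B₀ := by
  obtain ⟨B, hB⟩ := isCompact_Icc.exists_bound_of_continuousOn hf.contDiffOn.continuousOn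
  refine ⟨max B 0, le_max_right _ _, fun x hx ↦ ?_⟩
  have := hB x hx
  rw [Real.norm_eq_abs] at this
  exact this.trans (le_max_left _ _)

/-- To the right of any `x ∈ [0, λ)` there is a zero-free interval `(x, x+h) ⊆ (x, λ)` of `f`
(`zeros_finite`). [folklore] -/
theorem exists_zeroFree_right (hf : IsProlateFunction lam n f) {x : ℝ} (hx : x ∈ Ico 0 lam) :
    ∃ h : ℝ, 0 < h ∧ x + h ≤ lam ∧ ∀ t ∈ Ioo x (x + h), f t ≠ 0 := by
  set Z : Set ℝ := ({y | y ∈ Ioo (-lam) lam ∧ f y = 0} ∩ Ioi x) ∪ {lam} with hZ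
  have hZf : Z.Finite := (hf.zeros_finite.inter_of_left _).union (finite_singleton _)
  have hZne : Z.Nonempty := ⟨lam, Or.inr rfl⟩
  obtain ⟨z₀, hz₀Z, hz₀min⟩ := Set.exists_min_image Z id hZf hZne
  have hz₀x : x < z₀ := by
    rcases hz₀Z with ⟨_, h⟩ | h
    · exact h
    · rw [mem_singleton_iff] at h; rw [h]; exact hx.2
  have hz₀l : z₀ ≤ lam := by simpa using hz₀min lam (Or.inr rfl)
  refine ⟨z₀ - x, by linarith, by linarith, fun t ht hft ↦ ?_⟩
  have htZ : t ∈ Z := Or.inl ⟨⟨⟨by linarith [hx.1, ht.1], by linarith [ht.2]⟩, hft⟩, ht.1⟩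
  have := hz₀min t htZ
  simp only [id] at this
  linarith [ht.2]

/-- On a zero-free closed interval inside `(−λ, λ)`, `f` has constant sign. [folklore] -/
theorem mul_pos_of_zeroFree (hf : IsProlateFunction lam n f) {a b : ℝ}
    (hab : Icc a b ⊆ Ioo (-lam) lam) (hz : ∀ t ∈ Icc a b, f t ≠ 0) {x y : ℝ} (hx : x ∈ Icc a b)
    (hy : y ∈ Icc a b) : 0 < f x * f y := by
  by_contra hcon
  have hle : f x * f y ≤ 0 := not_lt.1 hcon
  have hsub : uIcc x y ⊆ Icc a b := uIcc_subset_Icc hx hy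
  have hcont : ContinuousOn f (uIcc x y) :=
    hf.contDiffOn.continuousOn.mono (hsub.trans (hab.trans Ioo_subset_Icc_self))
  have hfx : f x ≠ 0 := hz x hx
  have h0 : (0 : ℝ) ∈ uIcc (f x) (f y) := by
    rw [mem_uIcc]
    rcases lt_or_gt_of_ne hfx with h | h
    · left; exact ⟨h.le, by nlinarith⟩
    · right; exact ⟨by nlinarith, h.le⟩
  obtain ⟨c, hc, hfc⟩ := intermediate_value_uIcc hcont h0
  exact hz c (hsub hc) hfc

/-- The prolate function through the generic mechanism, for either sign `s = ±1`. [folklore] -/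
theorem turning_false (hf : IsProlateFunction lam n f) {χ : ℝ}
    (hχ : ∀ x ∈ Ioo (-lam) lam,
      -(deriv (fun y ↦ (lam ^ 2 - y ^ 2) * deriv f y) x) + (2 * π * lam * x) ^ 2 * f x = χ * f x)
    {x₀ h s : ℝ} (hs : s = 1 ∨ s = -1) (hx₀ : 0 ≤ x₀) (hx₀l : x₀ < lam)
    (hχ₀ : χ ≤ (2 * π * lam * x₀) ^ 2) (h0 : 0 ≤ s * f x₀) (h0' : 0 ≤ s * deriv f x₀)
    (hh : 0 < h) (hpos : ∀ x ∈ Ioo x₀ (x₀ + h), 0 < s * f x) : False := by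
  obtain ⟨B, hB⟩ := hf.exists_bound_deriv
  have hI : ∀ x ∈ Ico x₀ lam, x ∈ Ioo (-lam) lam := fun x hx ↦ ⟨by linarith [hx.1, hx.2], hx.2⟩
  have habs : |s| = 1 := by rcases hs with h | h <;> simp [h]
  refine turning_false_aux (g := fun y ↦ s * f y) (g' := fun y ↦ s * deriv f y) (B := B)
    hx₀ hx₀l hχ₀ (fun x hx ↦ ((hf.differentiableAt (hI x hx)).hasDerivAt).const_mul s)
    (fun x hx ↦ ?_) (fun x hx ↦ ?_) h0 h0' hh hpos
  · have h := (hf.hasDerivAt_sqMulDeriv hχ (hI x hx)).const_mul s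
    have e : (fun y ↦ (lam ^ 2 - y ^ 2) * (s * deriv f y))
        = fun y ↦ s * ((lam ^ 2 - y ^ 2) * deriv f y) := by funext y; ring
    rw [e]
    exact h.congr_deriv (by ring)
  · rw [abs_mul, habs, one_mul]; exact (hB x (hI x hx)).2

/-- **No zeros past the turning point**: if `0 ≤ x₀`, `χ ≤ (2πλx₀)²`, then `f ≠ 0` on `[x₀, λ)`.
[cite: SlepianPollak1961, §III] -/
theorem ne_zero_of_turning (hf : IsProlateFunction lam n f) {χ : ℝ}
    (hχ : ∀ x ∈ Ioo (-lam) lam,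
      -(deriv (fun y ↦ (lam ^ 2 - y ^ 2) * deriv f y) x) + (2 * π * lam * x) ^ 2 * f x = χ * f x)
    {x₀ : ℝ} (hx₀ : 0 ≤ x₀) (hχ₀ : χ ≤ (2 * π * lam * x₀) ^ 2) {x : ℝ} (hx : x ∈ Ico x₀ lam) :
    f x ≠ 0 := by
  intro hfx
  have hlam := hf.lam_pos
  have hx0 : 0 ≤ x := hx₀.trans hx.1
  have hxI : x ∈ Ioo (-lam) lam := ⟨by linarith, hx.2⟩
  have hχx : χ ≤ (2 * π * lam * x) ^ 2 :=
    hχ₀.trans (pow_le_pow_left₀ (by positivity)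
      (mul_le_mul_of_nonneg_left hx.1 (by positivity)) 2)
  obtain ⟨h, hh, hxh, hzf⟩ := hf.exists_zeroFree_right ⟨hx0, hx.2⟩
  set t₀ : ℝ := x + h / 2 with ht₀
  have ht₀I : t₀ ∈ Ioo x (x + h) := ⟨by rw [ht₀]; linarith, by rw [ht₀]; linarith⟩
  -- constant sign on `(x, x+h)`
  have hsign : ∀ t ∈ Ioo x (x + h), 0 < f t * f t₀ := by
    intro t ht
    have hsub : Icc (min t t₀) (max t t₀) ⊆ Ioo x (x + h) := fun u hu ↦
      ⟨lt_of_lt_of_le (lt_min ht.1 ht₀I.1) hu.1, lt_of_le_of_lt hu.2 (max_lt ht.2 ht₀I.2)⟩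
    exact hf.mul_pos_of_zeroFree (a := min t t₀) (b := max t t₀)
      (fun u hu ↦ ⟨by linarith [(hsub hu).1], by linarith [(hsub hu).2]⟩)
      (fun u hu ↦ hzf u (hsub hu)) ⟨min_le_left _ _, le_max_left _ _⟩
      ⟨min_le_right _ _, le_max_right _ _⟩
  have hdc : ContinuousAt (deriv f) x := (hf.continuousOn_deriv x hxI).continuousAt
    (isOpen_Ioo.mem_nhds hxI)
  have hfc : ContinuousOn f (Icc (-lam) lam) := hf.contDiffOn.continuousOn
  rcases lt_or_gt_of_ne (hzf t₀ ht₀I) with hneg | hposv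
  · -- `f < 0` on `(x, x+h)`: then `f′(x) ≤ 0`, and the mechanism applies to `−f`
    have hneg' : ∀ t ∈ Ioo x (x + h), f t < 0 := fun t ht ↦ by
      have := hsign t ht; nlinarith
    have hd : deriv f x ≤ 0 := by
      by_contra hd
      have hd' : 0 < deriv f x := not_le.1 hd
      obtain ⟨δ, hδ, hδ'⟩ := Metric.eventually_nhds_iff.1 (hdc.eventually (eventually_gt_nhds hd'))
      set δ' : ℝ := min δ h / 2 with hδ'def
      have hδ'0 : 0 < δ' := by rw [hδ'def]; positivity
      have hδ'1 : δ' < δ := by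
        rw [hδ'def]; have := min_le_left δ h; linarith
      have hδ'2 : δ' < h := by
        rw [hδ'def]; have := min_le_right δ h; linarith
      have hmono : StrictMonoOn f (Icc x (x + δ')) := by
        refine strictMonoOn_of_deriv_pos (convex_Icc _ _)
          (hfc.mono (Icc_subset_Icc (by linarith) (by linarith))) fun t ht ↦ ?_
        rw [interior_Icc] at ht
        exact hδ' (by rw [dist_eq, abs_lt]; constructor <;> linarith [ht.1, ht.2])
      have := hmono (left_mem_Icc.2 (by linarith)) (right_mem_Icc.2 (by linarith)) (by linarith)
      rw [hfx] at this
      linarith [hneg' (x + δ') ⟨by linarith, by linarith⟩]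
    exact hf.turning_false hχ (s := -1) (Or.inr rfl) hx0 hx.2 hχx (by rw [hfx]; simp)
      (by linarith) hh (fun t ht ↦ by have := hneg' t ht; linarith)
  · -- `f > 0` on `(x, x+h)`: then `f′(x) ≥ 0`, and the mechanism applies to `f`
    have hpos' : ∀ t ∈ Ioo x (x + h), 0 < f t := fun t ht ↦ by
      have := hsign t ht; nlinarith
    have hd : 0 ≤ deriv f x := by
      by_contra hd
      have hd' : deriv f x < 0 := not_le.1 hd
      obtain ⟨δ, hδ, hδ'⟩ := Metric.eventually_nhds_iff.1 (hdc.eventually (eventually_lt_nhds hd'))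
      set δ' : ℝ := min δ h / 2 with hδ'def
      have hδ'0 : 0 < δ' := by rw [hδ'def]; positivity
      have hδ'1 : δ' < δ := by
        rw [hδ'def]; have := min_le_left δ h; linarith
      have hδ'2 : δ' < h := by
        rw [hδ'def]; have := min_le_right δ h; linarith
      have hmono : StrictAntiOn f (Icc x (x + δ')) := by
        refine strictAntiOn_of_deriv_neg (convex_Icc _ _)
          (hfc.mono (Icc_subset_Icc (by linarith) (by linarith))) fun t ht ↦ ?_
        rw [interior_Icc] at ht
        exact hδ' (by rw [dist_eq, abs_lt]; constructor <;> linarith [ht.1, ht.2])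
      have := hmono (left_mem_Icc.2 (by linarith)) (right_mem_Icc.2 (by linarith)) (by linarith)
      rw [hfx] at this
      linarith [hpos' (x + δ') ⟨by linarith, by linarith⟩]
    exact hf.turning_false hχ (s := 1) (Or.inl rfl) hx0 hx.2 hχx (by rw [hfx]; simp)
      (by linarith) hh (fun t ht ↦ by have := hpos' t ht; linarith)

/-- **Strict decay past the turning point**: `f(x)·f′(x) < 0` on `[x₀, λ)` (`0 ≤ x₀`,
`χ ≤ (2πλx₀)²`). [cite: SlepianPollak1961, §III] -/
theorem mul_deriv_neg_of_turning (hf : IsProlateFunction lam n f) {χ : ℝ}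
    (hχ : ∀ x ∈ Ioo (-lam) lam,
      -(deriv (fun y ↦ (lam ^ 2 - y ^ 2) * deriv f y) x) + (2 * π * lam * x) ^ 2 * f x = χ * f x)
    {x₀ : ℝ} (hx₀ : 0 ≤ x₀) (hχ₀ : χ ≤ (2 * π * lam * x₀) ^ 2) {x : ℝ} (hx : x ∈ Ico x₀ lam) :
    f x * deriv f x < 0 := by
  have hlam := hf.lam_pos
  have hx0 : 0 ≤ x := hx₀.trans hx.1
  have hxI : x ∈ Ioo (-lam) lam := ⟨by linarith, hx.2⟩
  have hχx : χ ≤ (2 * π * lam * x) ^ 2 :=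
    hχ₀.trans (pow_le_pow_left₀ (by positivity)
      (mul_le_mul_of_nonneg_left hx.1 (by positivity)) 2)
  have hfx : f x ≠ 0 := hf.ne_zero_of_turning hχ hx₀ hχ₀ hx
  have hfc : ContinuousAt f x :=
    (hf.contDiffOn.continuousOn x (Ioo_subset_Icc_self hxI)).continuousAt (Icc_mem_nhds hxI.1 hxI.2)
  by_contra hcon
  have hge : 0 ≤ f x * deriv f x := not_lt.1 hcon
  rcases lt_or_gt_of_ne hfx with hneg | hposv
  · obtain ⟨δ, hδ, hδ'⟩ := Metric.eventually_nhds_iff.1 (hfc.eventually (eventually_lt_nhds hneg))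
    have hd : deriv f x ≤ 0 := by
      by_contra hd; have := mul_neg_of_neg_of_pos hneg (not_le.1 hd); linarith
    refine hf.turning_false hχ (s := -1) (h := min δ (lam - x)) (Or.inr rfl) hx0 hx.2 hχx
      (by nlinarith) (by nlinarith) (lt_min hδ (by linarith [hx.2])) fun t ht ↦ ?_
    have : f t < 0 := hδ' (by
      rw [dist_eq, abs_lt]; constructor <;> linarith [ht.1, ht.2, min_le_left δ (lam - x)])
    linarith
  · obtain ⟨δ, hδ, hδ'⟩ := Metric.eventually_nhds_iff.1 (hfc.eventually (eventually_gt_nhds hposv))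
    have hd : 0 ≤ deriv f x := by
      by_contra hd; have := mul_neg_of_pos_of_neg hposv (not_le.1 hd); linarith
    refine hf.turning_false hχ (s := 1) (h := min δ (lam - x)) (Or.inl rfl) hx0 hx.2 hχx
      (by nlinarith) (by nlinarith) (lt_min hδ (by linarith [hx.2])) fun t ht ↦ ?_
    have : 0 < f t := hδ' (by
      rw [dist_eq, abs_lt]; constructor <;> linarith [ht.1, ht.2, min_le_left δ (lam - x)])
    linarith

/-- Constant sign past the turning point: `f(x)f(y) > 0` for `x, y ∈ [x₀, λ)`. [folklore] -/
theorem mul_pos_of_turning (hf : IsProlateFunction lam n f) {χ : ℝ}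
    (hχ : ∀ x ∈ Ioo (-lam) lam,
      -(deriv (fun y ↦ (lam ^ 2 - y ^ 2) * deriv f y) x) + (2 * π * lam * x) ^ 2 * f x = χ * f x)
    {x₀ : ℝ} (hx₀ : 0 ≤ x₀) (hχ₀ : χ ≤ (2 * π * lam * x₀) ^ 2) {x y : ℝ} (hx : x ∈ Ico x₀ lam)
    (hy : y ∈ Ico x₀ lam) : 0 < f x * f y := by
  have hlam := hf.lam_pos
  have hsub : Icc (min x y) (max x y) ⊆ Ico x₀ lam := fun u hu ↦
    ⟨le_trans (le_min hx.1 hy.1) hu.1, lt_of_le_of_lt hu.2 (max_lt hx.2 hy.2)⟩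
  exact hf.mul_pos_of_zeroFree (a := min x y) (b := max x y)
    (fun u hu ↦ ⟨by linarith [(hsub hu).1], (hsub hu).2⟩)
    (fun u hu ↦ hf.ne_zero_of_turning hχ hx₀ hχ₀ (hsub hu)) ⟨min_le_left _ _, le_max_left _ _⟩
    ⟨min_le_right _ _, le_max_right _ _⟩

/-- **`|f|` decreases past the turning point**: `|f(y)| ≤ |f(x)|` for `x₀ ≤ x ≤ y < λ`.
[cite: SlepianPollak1961, §III] -/
theorem abs_antitoneOn_of_turning (hf : IsProlateFunction lam n f) {χ : ℝ}
    (hχ : ∀ x ∈ Ioo (-lam) lam,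
      -(deriv (fun y ↦ (lam ^ 2 - y ^ 2) * deriv f y) x) + (2 * π * lam * x) ^ 2 * f x = χ * f x)
    {x₀ : ℝ} (hx₀ : 0 ≤ x₀) (hχ₀ : χ ≤ (2 * π * lam * x₀) ^ 2) :
    AntitoneOn (fun x ↦ |f x|) (Ico x₀ lam) := by
  have hlam := hf.lam_pos
  intro x hx y hy hxy
  have hI : Icc x y ⊆ Ico x₀ lam := fun u hu ↦ ⟨hx.1.trans hu.1, lt_of_le_of_lt hu.2 hy.2⟩
  have hI' : Icc x y ⊆ Ioo (-lam) lam := fun u hu ↦ ⟨by linarith [(hI hu).1], (hI hu).2⟩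
  have hcont : ContinuousOn f (Icc x y) :=
    hf.contDiffOn.continuousOn.mono (hI'.trans Ioo_subset_Icc_self)
  have hdiff : DifferentiableOn ℝ f (interior (Icc x y)) := by
    rw [interior_Icc]; exact fun u hu ↦ (hf.differentiableAt (hI' (Ioo_subset_Icc_self hu))).differentiableWithinAt
  have hsgn : ∀ u ∈ Icc x y, 0 < f x * f u := fun u hu ↦ hf.mul_pos_of_turning hχ hx₀ hχ₀ hx (hI hu)
  have hfd : ∀ u ∈ Icc x y, f u * deriv f u < 0 := fun u hu ↦
    hf.mul_deriv_neg_of_turning hχ hx₀ hχ₀ (hI hu)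
  show |f y| ≤ |f x|
  rcases lt_or_gt_of_ne (hf.ne_zero_of_turning hχ hx₀ hχ₀ hx) with hneg | hposv
  · have hfneg : ∀ u ∈ Icc x y, f u < 0 := fun u hu ↦ by have := hsgn u hu; nlinarith
    have hmono : MonotoneOn f (Icc x y) := by
      refine monotoneOn_of_deriv_nonneg (convex_Icc _ _) hcont hdiff fun u hu ↦ ?_
      rw [interior_Icc] at hu
      have h1 := hfd u (Ioo_subset_Icc_self hu)
      have h2 := hfneg u (Ioo_subset_Icc_self hu)
      by_contra h; have := mul_pos_of_neg_of_neg h2 (not_le.1 h); linarith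
    have := hmono (left_mem_Icc.2 hxy) (right_mem_Icc.2 hxy) hxy
    rw [abs_of_neg hneg, abs_of_neg (hfneg y (right_mem_Icc.2 hxy))]
    linarith
  · have hfpos : ∀ u ∈ Icc x y, 0 < f u := fun u hu ↦ by have := hsgn u hu; nlinarith
    have hanti : AntitoneOn f (Icc x y) := by
      refine antitoneOn_of_deriv_nonpos (convex_Icc _ _) hcont hdiff fun u hu ↦ ?_
      rw [interior_Icc] at hu
      have h1 := hfd u (Ioo_subset_Icc_self hu)
      have h2 := hfpos u (Ioo_subset_Icc_self hu)
      by_contra h; have := mul_pos h2 (not_le.1 h); linarith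
    have := hanti (left_mem_Icc.2 hxy) (right_mem_Icc.2 hxy) hxy
    rw [abs_of_pos hposv, abs_of_pos (hfpos y (right_mem_Icc.2 hxy))]
    exact this

/-- At the end point: `|f(λ)| ≤ |f(x)|` for `x ∈ [x₀, λ)` (continuity on `[−λ, λ]`). [folklore] -/
theorem abs_apply_lam_le_of_turning (hf : IsProlateFunction lam n f) {χ : ℝ}
    (hχ : ∀ x ∈ Ioo (-lam) lam,
      -(deriv (fun y ↦ (lam ^ 2 - y ^ 2) * deriv f y) x) + (2 * π * lam * x) ^ 2 * f x = χ * f x)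
    {x₀ : ℝ} (hx₀ : 0 ≤ x₀) (hχ₀ : χ ≤ (2 * π * lam * x₀) ^ 2) {x : ℝ} (hx : x ∈ Ico x₀ lam) :
    |f lam| ≤ |f x| := by
  have hlam := hf.lam_pos
  have hcont : ContinuousOn (fun y ↦ |f y|) (Icc (-lam) lam) := hf.contDiffOn.continuousOn.abs
  have htend : Tendsto (fun y ↦ |f y|) (𝓝[Ioo x lam] lam) (𝓝 (|f lam|)) :=
    ((hcont lam (right_mem_Icc.2 (by linarith))).tendsto).mono_left
      (nhdsWithin_mono _ fun z hz ↦ ⟨by linarith [hz.1, hx.1], hz.2.le⟩)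
  haveI : (𝓝[Ioo x lam] lam).NeBot := right_nhdsWithin_Ioo_neBot hx.2
  exact le_of_tendsto htend (eventually_nhdsWithin_of_forall fun z hz ↦
    hf.abs_antitoneOn_of_turning hχ hx₀ hχ₀ hx ⟨hx.1.trans hz.1.le, hz.2⟩ hz.1.le)


/-! ### Tails past the turning point -/

/-- `∫_X^x((2πλt)² − χ)|f(t)|dt ≤ (λ²−X²)|f′(X)|` for `x₀ ≤ X ≤ x < λ`: the integrated prolate
equation `(λ²−x²)f′(x) − (λ²−X²)f′(X) = ∫_X^x((2πλt)²−χ)f` and the signs `f·f′ < 0`. [folklore] -/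
theorem integral_coef_mul_abs_le_of_turning (hf : IsProlateFunction lam n f) {χ : ℝ}
    (hχ : ∀ x ∈ Ioo (-lam) lam,
      -(deriv (fun y ↦ (lam ^ 2 - y ^ 2) * deriv f y) x) + (2 * π * lam * x) ^ 2 * f x = χ * f x)
    {x₀ : ℝ} (hx₀ : 0 ≤ x₀) (hχ₀ : χ ≤ (2 * π * lam * x₀) ^ 2) {X x : ℝ} (hX : X ∈ Ico x₀ lam)
    (hx : x ∈ Ico X lam) :
    ∫ t in X..x, ((2 * π * lam * t) ^ 2 - χ) * |f t| ≤ (lam ^ 2 - X ^ 2) * |deriv f X| := by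
  have hlam := hf.lam_pos
  have hX0 : 0 ≤ X := hx₀.trans hX.1
  have hxr : x ∈ Ico x₀ lam := ⟨hX.1.trans hx.1, hx.2⟩
  have ePX := hf.sqMulDeriv_eq_integral hχ ⟨hX0, hX.2⟩
  have ePx := hf.sqMulDeriv_eq_integral hχ ⟨hX0.trans hx.1, hx.2⟩
  have hcont : ContinuousOn (fun t ↦ ((2 * π * lam * t) ^ 2 - χ) * f t) (Icc 0 lam) :=
    (by fun_prop : Continuous fun t : ℝ ↦ (2 * π * lam * t) ^ 2 - χ).continuousOn.mul
      (hf.contDiffOn.continuousOn.mono (Icc_subset_Icc (by linarith) le_rfl))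
  have hiX : IntervalIntegrable (fun t ↦ ((2 * π * lam * t) ^ 2 - χ) * f t) volume 0 X :=
    (hcont.mono (by rw [uIcc_of_le hX0]; exact Icc_subset_Icc le_rfl hX.2.le)).intervalIntegrable
  have hix : IntervalIntegrable (fun t ↦ ((2 * π * lam * t) ^ 2 - χ) * f t) volume 0 x :=
    (hcont.mono (by rw [uIcc_of_le (hX0.trans hx.1)]; exact Icc_subset_Icc le_rfl hx.2.le))
      |>.intervalIntegrable
  have eint : ∫ t in X..x, ((2 * π * lam * t) ^ 2 - χ) * f t
      = (lam ^ 2 - x ^ 2) * deriv f x - (lam ^ 2 - X ^ 2) * deriv f X := by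
    rw [ePx, ePX, intervalIntegral.integral_interval_sub_left hix hiX]
  have hsgn : ∀ t ∈ Icc X x, 0 < f X * f t := fun t ht ↦
    hf.mul_pos_of_turning hχ hx₀ hχ₀ hX ⟨hX.1.trans ht.1, lt_of_le_of_lt ht.2 hx.2⟩
  have hdX := hf.mul_deriv_neg_of_turning hχ hx₀ hχ₀ hX
  have hdx := hf.mul_deriv_neg_of_turning hχ hx₀ hχ₀ hxr
  have hlX : 0 < lam ^ 2 - X ^ 2 := by nlinarith [hX.2]
  have hlx : 0 < lam ^ 2 - x ^ 2 := by nlinarith [hx.2, hX0.trans hx.1]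
  rcases lt_or_gt_of_ne (hf.ne_zero_of_turning hχ hx₀ hχ₀ hX) with hneg | hposv
  · have hfneg : ∀ t ∈ Icc X x, f t < 0 := fun t ht ↦ by have := hsgn t ht; nlinarith
    have e1 : ∫ t in X..x, ((2 * π * lam * t) ^ 2 - χ) * |f t|
        = -∫ t in X..x, ((2 * π * lam * t) ^ 2 - χ) * f t := by
      rw [← intervalIntegral.integral_neg]
      refine intervalIntegral.integral_congr fun t ht ↦ ?_
      rw [uIcc_of_le hx.1] at ht
      simp only [abs_of_neg (hfneg t ht)]; ring
    rw [e1, eint]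
    have h1 : 0 < deriv f X := by nlinarith
    have h2 : 0 < deriv f x := by have := hfneg x (right_mem_Icc.2 hx.1); nlinarith
    rw [abs_of_pos h1]
    nlinarith [mul_pos hlx h2]
  · have hfpos : ∀ t ∈ Icc X x, 0 < f t := fun t ht ↦ by have := hsgn t ht; nlinarith
    have e1 : ∫ t in X..x, ((2 * π * lam * t) ^ 2 - χ) * |f t|
        = ∫ t in X..x, ((2 * π * lam * t) ^ 2 - χ) * f t := by
      refine intervalIntegral.integral_congr fun t ht ↦ ?_
      rw [uIcc_of_le hx.1] at ht
      simp only [abs_of_pos (hfpos t ht)]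
    rw [e1, eint]
    have h1 : deriv f X < 0 := by nlinarith
    have h2 : deriv f x < 0 := by have := hfpos x (right_mem_Icc.2 hx.1); nlinarith
    rw [abs_of_neg h1]
    nlinarith [mul_pos hlx (neg_pos.2 h2)]

/-- **Tail integral bound**: `((2πλX)² − χ)∫_X^λ|f| ≤ (λ²−X²)|f′(X)|` for `X ≥ x₀` past the turning
point. [folklore] -/
theorem integral_abs_le_of_turning (hf : IsProlateFunction lam n f) {χ : ℝ}
    (hχ : ∀ x ∈ Ioo (-lam) lam,
      -(deriv (fun y ↦ (lam ^ 2 - y ^ 2) * deriv f y) x) + (2 * π * lam * x) ^ 2 * f x = χ * f x)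
    {x₀ : ℝ} (hx₀ : 0 ≤ x₀) (hχ₀ : χ ≤ (2 * π * lam * x₀) ^ 2) {X : ℝ} (hX : X ∈ Ico x₀ lam)
    (hcoef : χ < (2 * π * lam * X) ^ 2) :
    ((2 * π * lam * X) ^ 2 - χ) * ∫ t in X..lam, |f t| ≤ (lam ^ 2 - X ^ 2) * |deriv f X| := by
  have hlam := hf.lam_pos
  have hX0 : 0 ≤ X := hx₀.trans hX.1
  set m : ℝ := (2 * π * lam * X) ^ 2 - χ with hm
  have hm0 : 0 < m := by rw [hm]; linarith
  obtain ⟨B₀, hB₀, hB₀'⟩ := hf.exists_bound_Icc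
  have hfc : ContinuousOn (fun t ↦ |f t|) (Icc (-lam) lam) := hf.contDiffOn.continuousOn.abs
  have hint : ∀ a b, -lam ≤ a → a ≤ b → b ≤ lam →
      IntervalIntegrable (fun t ↦ |f t|) volume a b := fun a b ha hab hb ↦
    (hfc.mono (by rw [uIcc_of_le hab]; exact Icc_subset_Icc ha hb)).intervalIntegrable
  have hpart : ∀ x ∈ Ico X lam, m * ∫ t in X..x, |f t| ≤ (lam ^ 2 - X ^ 2) * |deriv f X| := by
    intro x hx
    rw [← intervalIntegral.integral_const_mul]
    refine le_trans ?_ (hf.integral_coef_mul_abs_le_of_turning hχ hx₀ hχ₀ hX hx)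
    have hc2 : ContinuousOn (fun t ↦ ((2 * π * lam * t) ^ 2 - χ) * |f t|) (uIcc X x) := by
      rw [uIcc_of_le hx.1]
      exact (by fun_prop : Continuous fun t : ℝ ↦ (2 * π * lam * t) ^ 2 - χ).continuousOn.mul
        (hfc.mono (Icc_subset_Icc (by linarith) hx.2.le))
    refine intervalIntegral.integral_mono_on hx.1
      ((hint X x (by linarith) hx.1 hx.2.le).const_mul m) hc2.intervalIntegrable fun t ht ↦ ?_
    refine mul_le_mul_of_nonneg_right ?_ (abs_nonneg _)
    have h1 : 2 * π * lam * X ≤ 2 * π * lam * t := mul_le_mul_of_nonneg_left ht.1 (by positivity)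
    have := pow_le_pow_left₀ (by positivity) h1 2
    rw [hm]; linarith
  refine le_of_forall_pos_le_add fun ε hε ↦ ?_
  set x : ℝ := max X (lam - ε / (m * B₀ + 1)) with hxdef
  have hq : 0 < ε / (m * B₀ + 1) := by positivity
  have hxX : X ≤ x := le_max_left _ _
  have hxl : x < lam := max_lt hX.2 (by linarith)
  have hlx : lam - x ≤ ε / (m * B₀ + 1) := by
    have := le_max_right X (lam - ε / (m * B₀ + 1)); rw [hxdef]; linarith
  have hsplit : ∫ t in X..lam, |f t| = (∫ t in X..x, |f t|) + ∫ t in x..lam, |f t| :=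
    (intervalIntegral.integral_add_adjacent_intervals (hint X x (by linarith) hxX hxl.le)
      (hint x lam (by linarith) hxl.le le_rfl)).symm
  have htail : ∫ t in x..lam, |f t| ≤ B₀ * (lam - x) := by
    have h := intervalIntegral.norm_integral_le_of_norm_le_const (a := x) (b := lam) (C := B₀)
      (f := fun t ↦ |f t|) fun t ht ↦ by
        rw [uIoc_of_le hxl.le] at ht
        rw [Real.norm_eq_abs, abs_abs]
        exact hB₀' t ⟨by linarith [ht.1], ht.2⟩
    rw [Real.norm_eq_abs, abs_of_pos (by linarith : (0 : ℝ) < lam - x)] at h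
    exact (le_abs_self _).trans h
  have h3 : m * (B₀ * (lam - x)) ≤ ε := by
    calc m * (B₀ * (lam - x)) ≤ m * (B₀ * (ε / (m * B₀ + 1))) := by gcongr
      _ = ε * (m * B₀ / (m * B₀ + 1)) := by field_simp
      _ ≤ ε * 1 := by
          gcongr; rw [div_le_one (by positivity)]; linarith
      _ = ε := mul_one ε
  rw [hsplit, mul_add]
  linarith [hpart x ⟨hxX, hxl⟩, mul_le_mul_of_nonneg_left htail hm0.le]

/-- **The end point value**: `((2πλX)² − χ)|f(λ)| ≤ (λ+X)|f′(X)|` (`|f|` decreasing, so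
`(λ−X)|f(λ)| ≤ ∫_X^λ|f|`). [folklore] -/
theorem abs_apply_lam_le_deriv_of_turning (hf : IsProlateFunction lam n f) {χ : ℝ}
    (hχ : ∀ x ∈ Ioo (-lam) lam,
      -(deriv (fun y ↦ (lam ^ 2 - y ^ 2) * deriv f y) x) + (2 * π * lam * x) ^ 2 * f x = χ * f x)
    {x₀ : ℝ} (hx₀ : 0 ≤ x₀) (hχ₀ : χ ≤ (2 * π * lam * x₀) ^ 2) {X : ℝ} (hX : X ∈ Ico x₀ lam)
    (hcoef : χ < (2 * π * lam * X) ^ 2) :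
    ((2 * π * lam * X) ^ 2 - χ) * |f lam| ≤ (lam + X) * |deriv f X| := by
  have hlam := hf.lam_pos
  have hX0 : 0 ≤ X := hx₀.trans hX.1
  have hfc : ContinuousOn (fun t ↦ |f t|) (Icc (-lam) lam) := hf.contDiffOn.continuousOn.abs
  have hi : IntervalIntegrable (fun t ↦ |f t|) volume X lam :=
    (hfc.mono (by rw [uIcc_of_le hX.2.le]; exact Icc_subset_Icc (by linarith) le_rfl)).intervalIntegrable
  have h1 : (lam - X) * |f lam| ≤ ∫ t in X..lam, |f t| := by
    have h := intervalIntegral.integral_mono_on hX.2.le intervalIntegrable_const hi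
      (f := fun _ ↦ |f lam|) (g := fun t ↦ |f t|) fun t ht ↦ by
        rcases eq_or_lt_of_le ht.2 with h | h
        · rw [h]
        · exact hf.abs_apply_lam_le_of_turning hχ hx₀ hχ₀ ⟨hX.1.trans ht.1, h⟩
    rw [intervalIntegral.integral_const, smul_eq_mul] at h
    linarith
  have h2 := hf.integral_abs_le_of_turning hχ hx₀ hχ₀ hX hcoef
  have hm0 : 0 < (2 * π * lam * X) ^ 2 - χ := by linarith
  have h3 : (lam - X) * (((2 * π * lam * X) ^ 2 - χ) * |f lam|)
      ≤ (lam - X) * ((lam + X) * |deriv f X|) := by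
    have := mul_le_mul_of_nonneg_left h1 hm0.le
    nlinarith
  exact le_of_mul_le_mul_left h3 (by linarith [hX.2])

/-- **Weighted tail of `f′`**: `∫_X^λ|f′|(1+x)dx ≤ (1+X)|f(X)| + ∫_X^λ|f| + (1+λ)|f(λ)|` for `X ≥ x₀`
past the turning point (integration by parts of `((1+x)f)′`, `f′` of constant sign). [folklore] -/
theorem integral_abs_deriv_mul_le_of_turning (hf : IsProlateFunction lam n f) {χ : ℝ}
    (hχ : ∀ x ∈ Ioo (-lam) lam,
      -(deriv (fun y ↦ (lam ^ 2 - y ^ 2) * deriv f y) x) + (2 * π * lam * x) ^ 2 * f x = χ * f x)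
    {x₀ : ℝ} (hx₀ : 0 ≤ x₀) (hχ₀ : χ ≤ (2 * π * lam * x₀) ^ 2) {X : ℝ} (hX : X ∈ Ico x₀ lam) :
    (∫ t in X..lam, |deriv f t| * (1 + t))
      ≤ (1 + X) * |f X| + (∫ t in X..lam, |f t|) + (1 + lam) * |f lam| := by
  have hlam := hf.lam_pos
  have hX0 : 0 ≤ X := hx₀.trans hX.1
  have hcf : ContinuousOn f (Icc X lam) :=
    hf.contDiffOn.continuousOn.mono (Icc_subset_Icc (by linarith) le_rfl)
  have hΦc : ContinuousOn (fun x ↦ (1 + x) * f x) (Icc X lam) :=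
    (continuousOn_const.add continuousOn_id).mul hcf
  have hderiv : ∀ x ∈ Ioo X lam,
      HasDerivAt (fun x ↦ (1 + x) * f x) (f x + (1 + x) * deriv f x) x := by
    intro x hx
    have h1 : HasDerivAt (fun x : ℝ ↦ 1 + x) 1 x := (hasDerivAt_id x).const_add 1
    have h2 := (hf.differentiableAt ⟨by linarith [hx.1], hx.2⟩).hasDerivAt
    exact (h1.mul h2).congr_deriv (by ring)
  have hsub : uIcc X lam ⊆ uIcc 0 lam := by
    rw [uIcc_of_le hX.2.le, uIcc_of_le hlam.le]; exact Icc_subset_Icc hX0 le_rfl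
  have hfi : IntervalIntegrable f volume X lam :=
    (hcf.mono (by rw [uIcc_of_le hX.2.le])).intervalIntegrable
  have hfai : IntervalIntegrable (fun t ↦ |f t|) volume X lam := hfi.abs
  have hdi : IntervalIntegrable (deriv f) volume X lam := hf.intervalIntegrable_deriv.mono_set hsub
  have hint : IntervalIntegrable (fun x ↦ f x + (1 + x) * deriv f x) volume X lam :=
    hfi.add (hdi.continuousOn_mul (by fun_prop))
  have hFTC := intervalIntegral.integral_eq_sub_of_hasDerivAt_of_le hX.2.le hΦc hderiv hint
  have hff : (∫ t in X..lam, f t) ≤ ∫ t in X..lam, |f t| :=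
    intervalIntegral.integral_mono_on hX.2.le hfi hfai fun t _ ↦ le_abs_self _
  have hff' : -(∫ t in X..lam, f t) ≤ ∫ t in X..lam, |f t| := by
    rw [← intervalIntegral.integral_neg]
    exact intervalIntegral.integral_mono_on hX.2.le hfi.neg hfai fun t _ ↦ neg_le_abs _
  have hsgn : ∀ t ∈ Ico X lam, 0 < f X * f t := fun t ht ↦
    hf.mul_pos_of_turning hχ hx₀ hχ₀ hX ⟨hX.1.trans ht.1, ht.2⟩
  have hfd : ∀ t ∈ Ico X lam, f t * deriv f t < 0 := fun t ht ↦
    hf.mul_deriv_neg_of_turning hχ hx₀ hχ₀ ⟨hX.1.trans ht.1, ht.2⟩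
  rcases lt_or_gt_of_ne (hf.ne_zero_of_turning hχ hx₀ hχ₀ hX) with hneg | hposv
  · -- `f < 0`, `f′ > 0` on `[X, λ)`
    have hd : ∀ t ∈ Ioo X lam, 0 ≤ deriv f t := fun t ht ↦ by
      have h1 := hsgn t (Ioo_subset_Ico_self ht)
      have h2 := hfd t (Ioo_subset_Ico_self ht)
      nlinarith
    have h1 : (∫ x in X..lam, |deriv f x| * (1 + x)) ≤ ∫ x in X..lam, deriv f x * (1 + x) := by
      refine intervalIntegral.integral_mono_on_of_le_Ioo hX.2.le (hdi.abs.mul_continuousOn (by fun_prop))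
        (hdi.mul_continuousOn (by fun_prop)) fun x hx ↦ ?_
      rw [abs_of_nonneg (hd x hx)]
    have h2 : (∫ x in X..lam, deriv f x * (1 + x))
        = ((1 + lam) * f lam - (1 + X) * f X) - ∫ x in X..lam, f x := by
      have : (fun x ↦ deriv f x * (1 + x)) = fun x ↦ (f x + (1 + x) * deriv f x) - f x := by
        funext x; ring
      rw [this, intervalIntegral.integral_sub hint hfi, hFTC]
    have h3 : (1 + lam) * f lam ≤ (1 + lam) * |f lam| :=
      mul_le_mul_of_nonneg_left (le_abs_self _) (by linarith)
    have h4 : -((1 + X) * f X) = (1 + X) * |f X| := by rw [abs_of_neg hneg]; ring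
    linarith
  · -- `f > 0`, `f′ < 0` on `[X, λ)`
    have hd : ∀ t ∈ Ioo X lam, deriv f t ≤ 0 := fun t ht ↦ by
      have h1 := hsgn t (Ioo_subset_Ico_self ht)
      have h2 := hfd t (Ioo_subset_Ico_self ht)
      nlinarith
    have h := hf.integral_abs_deriv_mul_le hX0 hX.2 hd
    rw [← abs_of_pos hposv] at h
    linarith

/-! ### The Riccati variable `w = −(λ²−x²)f′/(λ²f)` -/

/-- `w′ = (λ²−x²)f′²/(λ²f²) − ((2πλx)² − χ)/λ²` (`= λ²w²/(λ²−x²) − ((2πλx)²−χ)/λ²`) where `f ≠ 0`.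
[folklore] -/
theorem hasDerivAt_riccati (hf : IsProlateFunction lam n f) {χ : ℝ}
    (hχ : ∀ x ∈ Ioo (-lam) lam,
      -(deriv (fun y ↦ (lam ^ 2 - y ^ 2) * deriv f y) x) + (2 * π * lam * x) ^ 2 * f x = χ * f x)
    {y : ℝ} (hy : y ∈ Ioo (-lam) lam) (hfy : f y ≠ 0) :
    HasDerivAt (fun t ↦ -((lam ^ 2 - t ^ 2) * deriv f t) / (lam ^ 2 * f t))
      ((lam ^ 2 - y ^ 2) * deriv f y ^ 2 / (lam ^ 2 * f y ^ 2)
        - ((2 * π * lam * y) ^ 2 - χ) / lam ^ 2) y := by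
  have hlam := hf.lam_pos
  have hN := (hf.hasDerivAt_sqMulDeriv hχ hy).neg
  have hD := ((hf.differentiableAt hy).hasDerivAt).const_mul (lam ^ 2)
  have hD0 : lam ^ 2 * f y ≠ 0 := mul_ne_zero (by positivity) hfy
  have h := hN.div hD hD0
  refine h.congr_deriv ?_
  simp only [Pi.neg_apply]
  field_simp
  ring

/-- **Riccati upper bound**: for `0 ≤ X`, `X + 1 < λ`, `0 ≤ χ ≤ (2πλX)²`:
`−(λ²−X²)f′(X)/f(X) < λ²(2π(X+1) + 1)`.  Otherwise `w = −(λ²−x²)f′/(λ²f)` satisfies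
`w′ ≥ w² − K²` (`K = 2π(X+1)`) with `w(X) ≥ K + 1` and blows up before `X + 1` (fencing against
`K + 1/(c − (x−X))`), contradicting continuity of `w` on `[X, X+1]` (`f ≠ 0` there). [folklore] -/
theorem riccati_upper (hf : IsProlateFunction lam n f) {χ : ℝ}
    (hχ : ∀ x ∈ Ioo (-lam) lam,
      -(deriv (fun y ↦ (lam ^ 2 - y ^ 2) * deriv f y) x) + (2 * π * lam * x) ^ 2 * f x = χ * f x)
    (hχ0 : 0 ≤ χ) {X : ℝ} (hX0 : 0 ≤ X) (hX1 : X + 1 < lam) (hχX : χ ≤ (2 * π * lam * X) ^ 2) :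
    -((lam ^ 2 - X ^ 2) * deriv f X) / f X < lam ^ 2 * (2 * π * (X + 1) + 1) := by
  have hlam := hf.lam_pos
  set K : ℝ := 2 * π * (X + 1) with hK
  have hK0 : 0 < K := by positivity
  set w : ℝ → ℝ := fun t ↦ -((lam ^ 2 - t ^ 2) * deriv f t) / (lam ^ 2 * f t) with hw
  set w' : ℝ → ℝ := fun t ↦ (lam ^ 2 - t ^ 2) * deriv f t ^ 2 / (lam ^ 2 * f t ^ 2)
    - ((2 * π * lam * t) ^ 2 - χ) / lam ^ 2 with hw'
  by_contra H
  have H' : lam ^ 2 * (K + 1) ≤ -((lam ^ 2 - X ^ 2) * deriv f X) / f X := not_lt.1 H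
  have hreg : ∀ t ∈ Icc X (X + 1), t ∈ Ico X lam := fun t ht ↦ ⟨ht.1, lt_of_le_of_lt ht.2 hX1⟩
  have hI : ∀ t ∈ Icc X (X + 1), t ∈ Ioo (-lam) lam := fun t ht ↦
    ⟨by linarith [ht.1], lt_of_le_of_lt ht.2 hX1⟩
  have hfne : ∀ t ∈ Icc X (X + 1), f t ≠ 0 := fun t ht ↦
    hf.ne_zero_of_turning hχ hX0 hχX (hreg t ht)
  have hwd : ∀ t ∈ Icc X (X + 1), HasDerivAt w (w' t) t := fun t ht ↦
    hf.hasDerivAt_riccati hχ (hI t ht) (hfne t ht)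
  have hwc : ContinuousOn w (Icc X (X + 1)) := fun t ht ↦ (hwd t ht).continuousAt.continuousWithinAt
  have hwX : K + 1 ≤ w X := by
    have e : w X = (-((lam ^ 2 - X ^ 2) * deriv f X) / f X) / lam ^ 2 := by
      simp only [hw]; rw [mul_comm (lam ^ 2) (f X), div_div]
    rw [e, le_div_iff₀ (by positivity)]
    linarith
  -- the Riccati inequality
  have hineq : ∀ t ∈ Icc X (X + 1), K < w t → (w t - K) ^ 2 < w' t := by
    intro t ht hKt
    have hlt : 0 < lam ^ 2 - t ^ 2 := by nlinarith [ht.1, ht.2, hX1]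
    have hft : f t ≠ 0 := hfne t ht
    have hf2 : 0 < f t ^ 2 := by positivity
    have e1 : w t ^ 2 = ((lam ^ 2 - t ^ 2) / lam ^ 2)
        * ((lam ^ 2 - t ^ 2) * deriv f t ^ 2 / (lam ^ 2 * f t ^ 2)) := by
      simp only [hw]; field_simp; try ring
    have e2 : (lam ^ 2 - t ^ 2) / lam ^ 2 ≤ 1 := by
      rw [div_le_one (by positivity)]; nlinarith
    have h3 : 0 ≤ (lam ^ 2 - t ^ 2) * deriv f t ^ 2 / (lam ^ 2 * f t ^ 2) := by positivity
    have h4 : w t ^ 2 ≤ (lam ^ 2 - t ^ 2) * deriv f t ^ 2 / (lam ^ 2 * f t ^ 2) := by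
      rw [e1]; exact mul_le_of_le_one_left h3 e2
    have h5 : ((2 * π * lam * t) ^ 2 - χ) / lam ^ 2 ≤ K ^ 2 := by
      rw [div_le_iff₀ (by positivity), hK]
      have ht1 : 2 * π * lam * t ≤ 2 * π * lam * (X + 1) :=
        mul_le_mul_of_nonneg_left ht.2 (by positivity)
      have ht0 : 0 ≤ 2 * π * lam * t := by have := hX0.trans ht.1; positivity
      have h6 := pow_le_pow_left₀ ht0 ht1 2
      nlinarith
    have h6 : w t ^ 2 - K ^ 2 ≤ w' t := by simp only [hw']; linarith
    nlinarith [mul_pos hK0 (sub_pos.2 hKt)]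
  -- the blow-up comparison function `K + 1/(c − (t − X))`
  set c : ℝ := 1 / (w X - K) with hc
  have hcpos : 0 < c := by rw [hc]; exact one_div_pos.2 (by linarith)
  have hc1 : c ≤ 1 := by rw [hc, div_le_one (by linarith)]; linarith
  obtain ⟨Wm, hWm⟩ := isCompact_Icc.exists_bound_of_continuousOn hwc
  set η : ℝ := min (c / 2) (1 / (|Wm| + |K| + 1)) with hη
  have hη0 : 0 < η := lt_min (by positivity) (by positivity)
  have hηc : η ≤ c / 2 := min_le_left _ _
  set b : ℝ := X + c - η with hb
  have hbX : X ≤ b := by rw [hb]; linarith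
  have hbc : b < X + c := by rw [hb]; linarith
  have hb1 : b ≤ X + 1 := by linarith
  set Bf : ℝ → ℝ := fun t ↦ K + (c - (t - X))⁻¹ with hBf
  have hBd : ∀ t ∈ Ico X b, HasDerivAt Bf ((Bf t - K) ^ 2) t := by
    intro t ht
    have hne : c - (t - X) ≠ 0 := by linarith [ht.2]
    have h1 : HasDerivAt (fun s : ℝ ↦ c - (s - X)) (-1) t := by
      simpa using ((hasDerivAt_id t).sub_const X).const_sub c
    have h3 := (h1.inv hne).const_add K
    refine h3.congr_deriv ?_
    simp only [hBf]
    field_simp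
    ring
  have hBc : ContinuousOn Bf (Icc X b) := by
    refine continuousOn_const.add (ContinuousOn.inv₀ (by fun_prop) fun t ht ↦ ?_)
    linarith [ht.2]
  have hbase : Bf X ≤ w X := by
    simp only [hBf, hc]; rw [sub_self, sub_zero, one_div, inv_inv]; linarith
  have hfence := image_le_of_deriv_right_lt_deriv_boundary' (f := Bf)
    (f' := fun t ↦ (Bf t - K) ^ 2) (a := X) (b := b) hBc (fun t ht ↦ (hBd t ht).hasDerivWithinAt)
    (B := w) (B' := w') hbase (hwc.mono (Icc_subset_Icc le_rfl hb1))
    (fun t ht ↦ (hwd t ⟨ht.1, ht.2.le.trans hb1⟩).hasDerivWithinAt) fun t ht heq ↦ by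
      have hpos : 0 < (c - (t - X))⁻¹ := inv_pos.2 (by linarith [ht.2])
      have hKt : K < w t := by rw [← heq]; simp only [hBf]; linarith
      rw [heq]
      exact hineq t ⟨ht.1, ht.2.le.trans hb1⟩ hKt
  have hBb : Bf b ≤ w b := hfence (right_mem_Icc.2 hbX)
  have hwb : w b ≤ Wm := by
    have := hWm b ⟨hbX, hb1⟩
    rw [Real.norm_eq_abs] at this
    exact (le_abs_self _).trans this
  have hden : c - (b - X) = η := by rw [hb]; ring
  have hBbv : Bf b = K + η⁻¹ := by simp only [hBf, hden]
  have hη1 : |Wm| + |K| + 1 ≤ η⁻¹ := by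
    rw [← one_div, le_one_div (by positivity) hη0]
    exact min_le_right _ _
  have hKK : 0 ≤ K + |K| := by have := neg_abs_le K; linarith
  linarith [le_abs_self Wm]

/-- **Riccati lower bound**: for `0 < θ`, `0 < p₀` with `p₀λ² ≤ λ² − (X+1)²`, `χ ≤ (2πλX)²`, `0 ≤ X`
and `2πθX ≤ 4π²X²(1 − θ²/p₀) − χ/λ²`: `−(λ²−X²)f′(X)/f(X) ≥ λ²·2πθX`.  Otherwise
`w′ = λ²w²/(λ²−x²) − ((2πλx)²−χ)/λ² < −2πθX` along the line `w(X) − 2πθX·(x − X)`, so `w` (fenced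
below it) would be negative at `X + 1`, contradicting `w > 0` (`f·f′ < 0`). [folklore] -/
theorem riccati_lower (hf : IsProlateFunction lam n f) {χ : ℝ}
    (hχ : ∀ x ∈ Ioo (-lam) lam,
      -(deriv (fun y ↦ (lam ^ 2 - y ^ 2) * deriv f y) x) + (2 * π * lam * x) ^ 2 * f x = χ * f x)
    {X θ p₀ : ℝ} (hX0 : 0 ≤ X) (hθ : 0 < θ) (hp₀ : 0 < p₀)
    (hlamp : p₀ * lam ^ 2 ≤ lam ^ 2 - (X + 1) ^ 2) (hχX : χ ≤ (2 * π * lam * X) ^ 2)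
    (hm : 2 * π * θ * X ≤ 4 * π ^ 2 * X ^ 2 * (1 - θ ^ 2 / p₀) - χ / lam ^ 2) :
    lam ^ 2 * (2 * π * θ * X) ≤ -((lam ^ 2 - X ^ 2) * deriv f X) / f X := by
  have hlam := hf.lam_pos
  have hX1 : X + 1 < lam := by
    have h1 : (X + 1) ^ 2 < lam ^ 2 := by nlinarith [mul_pos hp₀ (pow_pos hlam 2)]
    nlinarith
  set L : ℝ := 2 * π * θ * X with hL
  have hL0 : 0 ≤ L := by positivity
  set w : ℝ → ℝ := fun t ↦ -((lam ^ 2 - t ^ 2) * deriv f t) / (lam ^ 2 * f t) with hw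
  set w' : ℝ → ℝ := fun t ↦ (lam ^ 2 - t ^ 2) * deriv f t ^ 2 / (lam ^ 2 * f t ^ 2)
    - ((2 * π * lam * t) ^ 2 - χ) / lam ^ 2 with hw'
  by_contra H
  have H' : -((lam ^ 2 - X ^ 2) * deriv f X) / f X < lam ^ 2 * L := not_le.1 H
  have hreg : ∀ t ∈ Icc X (X + 1), t ∈ Ico X lam := fun t ht ↦ ⟨ht.1, lt_of_le_of_lt ht.2 hX1⟩
  have hI : ∀ t ∈ Icc X (X + 1), t ∈ Ioo (-lam) lam := fun t ht ↦
    ⟨by linarith [ht.1], lt_of_le_of_lt ht.2 hX1⟩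
  have hfne : ∀ t ∈ Icc X (X + 1), f t ≠ 0 := fun t ht ↦
    hf.ne_zero_of_turning hχ hX0 hχX (hreg t ht)
  have hwd : ∀ t ∈ Icc X (X + 1), HasDerivAt w (w' t) t := fun t ht ↦
    hf.hasDerivAt_riccati hχ (hI t ht) (hfne t ht)
  have hwc : ContinuousOn w (Icc X (X + 1)) := fun t ht ↦ (hwd t ht).continuousAt.continuousWithinAt
  have hwX : w X < L := by
    have e : w X = (-((lam ^ 2 - X ^ 2) * deriv f X) / f X) / lam ^ 2 := by
      simp only [hw]; rw [mul_comm (lam ^ 2) (f X), div_div]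
    rw [e, div_lt_iff₀ (by positivity)]
    linarith
  have hwpos : ∀ t ∈ Icc X (X + 1), 0 < w t := by
    intro t ht
    have h := hf.mul_deriv_neg_of_turning hχ hX0 hχX (hreg t ht)
    have hlt : 0 < lam ^ 2 - t ^ 2 := by nlinarith [ht.1, ht.2, hX1]
    have hft := hfne t ht
    have e : w t = (lam ^ 2 - t ^ 2) / lam ^ 2 * (-(f t * deriv f t) / f t ^ 2) := by
      simp only [hw]; field_simp; try ring
    rw [e]
    have : 0 < -(f t * deriv f t) / f t ^ 2 := div_pos (by linarith) (by positivity)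
    positivity
  have hineq : ∀ t ∈ Icc X (X + 1), 0 < w t → w t < L → w' t < -L := by
    intro t ht h0 hLt
    have hlt : 0 < lam ^ 2 - t ^ 2 := by nlinarith [ht.1, ht.2, hX1]
    have hft := hfne t ht
    have e1 : w' t = w t ^ 2 * (lam ^ 2 / (lam ^ 2 - t ^ 2))
        - ((2 * π * lam * t) ^ 2 - χ) / lam ^ 2 := by
      simp only [hw, hw']; field_simp; try ring
    have h2 : lam ^ 2 / (lam ^ 2 - t ^ 2) ≤ 1 / p₀ := by
      rw [div_le_div_iff₀ hlt hp₀]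
      have ht0 : 0 ≤ t := hX0.trans ht.1
      nlinarith [ht.2]
    have h3 : w t ^ 2 ≤ L ^ 2 := by nlinarith
    have h3' : w t ^ 2 < L ^ 2 := by nlinarith
    have h4 : ((2 * π * lam * X) ^ 2 - χ) / lam ^ 2 ≤ ((2 * π * lam * t) ^ 2 - χ) / lam ^ 2 := by
      apply div_le_div_of_nonneg_right _ (by positivity)
      have h1 : 2 * π * lam * X ≤ 2 * π * lam * t := mul_le_mul_of_nonneg_left ht.1 (by positivity)
      have := pow_le_pow_left₀ (by positivity) h1 2
      linarith
    have h5 : ((2 * π * lam * X) ^ 2 - χ) / lam ^ 2 = 4 * π ^ 2 * X ^ 2 - χ / lam ^ 2 := by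
      field_simp; ring
    have h6 : w t ^ 2 * (lam ^ 2 / (lam ^ 2 - t ^ 2)) ≤ w t ^ 2 * (1 / p₀) :=
      mul_le_mul_of_nonneg_left h2 (sq_nonneg _)
    have h7 : w t ^ 2 * (1 / p₀) < L ^ 2 * (1 / p₀) :=
      mul_lt_mul_of_pos_right h3' (by positivity)
    have h8 : L ^ 2 * (1 / p₀) = 4 * π ^ 2 * X ^ 2 * (θ ^ 2 / p₀) := by
      rw [hL]; field_simp; ring
    rw [e1]
    linarith [h4, h5, h6, h7, h8, hm]
  set Bf : ℝ → ℝ := fun t ↦ w X - L * (t - X) with hBf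
  have hBd : ∀ t, HasDerivAt Bf (-L) t := by
    intro t
    have h1 : HasDerivAt (fun s : ℝ ↦ L * (s - X)) (L * 1) t :=
      ((hasDerivAt_id t).sub_const X).const_mul L
    have h2 := h1.const_sub (w X)
    refine h2.congr_deriv ?_
    ring
  have hfence := image_le_of_deriv_right_lt_deriv_boundary' (f := w) (f' := w') (a := X)
    (b := X + 1) hwc (fun t ht ↦ (hwd t ⟨ht.1, ht.2.le⟩).hasDerivWithinAt) (B := Bf)
    (B' := fun _ ↦ -L) (by simp [hBf]) (fun t _ ↦ (hBd t).continuousAt.continuousWithinAt)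
    (fun t _ ↦ (hBd t).hasDerivWithinAt) fun t ht heq ↦ by
      have h0 := hwpos t ⟨ht.1, ht.2.le⟩
      have hLt : w t < L := by
        rw [heq]; simp only [hBf]
        nlinarith [ht.1]
      exact hineq t ⟨ht.1, ht.2.le⟩ h0 hLt
  have h1 : w (X + 1) ≤ Bf (X + 1) := hfence (right_mem_Icc.2 (by linarith))
  have h2 : Bf (X + 1) = w X - L := by simp only [hBf]; ring
  linarith [hwpos (X + 1) (right_mem_Icc.2 (by linarith))]

end IsProlateFunction

end Literature.NumberTheory.LFunctions
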